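import Literature.Probability.LatticeModels.HighDimTrivialityWick
import Literature.Probability.LatticeModels.CriticalWickDichotomy
import Summits.CriticalPhenomena.Ising3DConformalLimit.Theses.HyperoctahedralRP
import Summits.CriticalPhenomena.Ising3DConformalLimit.Theorems.InversionUpgradeNormalised.Negative.AutomaticOrders
import HarnessLib

/-!
# Stub 6c `stub_clustering_of_oddOddDecay` of line `Sketch` (crux stmt-CriticalPhenomena-1344 `MoebiusLimitExists`)
= the bookkeeping step of item stmt-1982's `stub_clustering` (line `free-endpoint-gaussian-closure`)

CLUSTERING (OS4) `S_{n+m}(x, y + t v) - S_n(x) S_m(y) → 0` of every normalised, non-degenerate, Euclidean-invariant,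
scale-covariant pointwise limit of `criticalCorr 3`, from the odd|odd decay (stub 6b's conclusion, hypothesis) and
the two-sided Glimm–Jaffe pair truncation in the limit (1982's landed `stub_pairTruncation`, hypothesis).
-/

noncomputable section

open Filter Topology
open Literature.Probability.LatticeModels
open EuclideanGeometry

namespace Summit.CriticalPhenomena.Ising3DConformalLimit.Cruxes.InversionUpgradeNormalised.FreeEndpointGaussianClosure

/-- For injective configurations `x`, `y` and a direction `v ≠ 0`, the appended configuration
`(x, y + t v)` is injective for all sufficiently large `t` (namely as soon as
`t ‖v‖ > Σᵢⱼ ‖xᵢ - yⱼ‖`). [folklore] -/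
theorem eventually_injective_append_add_smul {n m : ℕ} {x : Fin n → EuclideanSpace ℝ (Fin 3)}
    {y : Fin m → EuclideanSpace ℝ (Fin 3)} {v : EuclideanSpace ℝ (Fin 3)}
    (hx : Function.Injective x) (hy : Function.Injective y) (hv : v ≠ 0) :
    ∀ᶠ t : ℝ in atTop, Function.Injective (Fin.append x (fun j => y j + t • v)) := by
  have hvpos : 0 < ‖v‖ := norm_pos_iff.mpr hv
  filter_upwards [Filter.eventually_gt_atTop ((∑ i, ∑ j, ‖x i - y j‖) / ‖v‖)] with t ht
  rw [div_lt_iff₀ hvpos] at ht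
  have hcross : ∀ i j, x i ≠ y j + t • v := by
    intro i j h
    have h1 : ‖x i - y j‖ = |t| * ‖v‖ := by
      rw [h, add_sub_cancel_left, norm_smul, Real.norm_eq_abs]
    have h2 : ‖x i - y j‖ ≤ ∑ i, ∑ j, ‖x i - y j‖ :=
      (Finset.single_le_sum (f := fun j => ‖x i - y j‖) (fun j _ => norm_nonneg _)
        (Finset.mem_univ j)).trans
      (Finset.single_le_sum (f := fun i => ∑ j, ‖x i - y j‖)
        (fun i _ => Finset.sum_nonneg fun j _ => norm_nonneg _) (Finset.mem_univ i))
    have h3 : t * ‖v‖ ≤ |t| * ‖v‖ := mul_le_mul_of_nonneg_right (le_abs_self t) hvpos.le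
    linarith
  exact Fin.append_injective_iff.mpr ⟨hx, fun j j' h => hy (add_right_cancel h), hcross⟩

/-- In `Fin n` with `n` even, the complement of an odd subset is odd. [folklore] -/
theorem odd_card_compl_of_even {n : ℕ} (hn : Even n) {I : Finset (Fin n)} (hI : Odd I.card) :
    Odd Iᶜ.card := by
  rw [Finset.card_compl, Fintype.card_fin]
  exact Nat.Even.sub_odd ((Finset.card_le_univ I).trans_eq (Fintype.card_fin n)) hn hI

/-- **Clustering from odd|odd decay and pair truncation.** Cases: `x` or `y` not injective (both terms `≡ 0` by
normalisation); `n + m` odd (both terms vanish, `InversionUpgradeNormalisedNegative.limit_odd_eq_zero`); `n, m` odd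
(`S_n(x) = 0`, then the hypothesis); `n, m` even (eventually injective appended configuration, two-sided pair
truncation with `S_m(y + t v) = S_m(y)` by translation invariance, each odd|odd term a product of two decaying
quantities, squeeze). [cite: GlimmJaffe1987, Cor. 4.3.3 and §19.3] -/
theorem stub_clustering_of_oddOddDecay :
    (∀ (ρ : ℝ → ℝ) (Δ : ℝ) (S : CorrFamily 3), (∀ δ ∈ Set.Ioc (0:ℝ) 1, 0 < ρ δ) →
      HasPointwiseScalingLimit (criticalCorr 3) ρ S → (∀ n z, z ∉ NonCoincident 3 n → S n z = 0) →
      IsNondegenerateTwoPoint S → IsEuclideanInvariant S → IsScaleCovariant Δ S →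
      ∀ (n m : ℕ) (x : Fin n → EuclideanSpace ℝ (Fin 3)) (y : Fin m → EuclideanSpace ℝ (Fin 3))
        (v : EuclideanSpace ℝ (Fin 3)), Odd n → Odd m → v ≠ 0 →
        Tendsto (fun t : ℝ => S (n + m) (Fin.append x (fun j => y j + t • v))) atTop (𝓝 0)) →
    (∀ (ρ : ℝ → ℝ) (S : CorrFamily 3), (∀ δ ∈ Set.Ioc (0:ℝ) 1, 0 < ρ δ) →
      HasPointwiseScalingLimit (criticalCorr 3) ρ S →
      ∀ (p q : ℕ) (x : Fin p → EuclideanSpace ℝ (Fin 3)) (y : Fin q → EuclideanSpace ℝ (Fin 3)),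
        Even p → Even q → Function.Injective (Fin.append x y) →
        0 ≤ S (p + q) (Fin.append x y) - S p x * S q y ∧
        2 * (S (p + q) (Fin.append x y) - S p x * S q y) ≤
          ∑ I ∈ (Finset.univ : Finset (Fin p)).powerset.filter (fun I => Odd I.card),
            ∑ J ∈ (Finset.univ : Finset (Fin q)).powerset.filter (fun J => Odd J.card),
              S (I.card + J.card)
                  (Fin.append (fun i => x (I.orderEmbOfFin rfl i)) (fun j => y (J.orderEmbOfFin rfl j))) *
                S (Iᶜ.card + Jᶜ.card)
                  (Fin.append (fun i => x (Iᶜ.orderEmbOfFin rfl i)) (fun j => y (Jᶜ.orderEmbOfFin rfl j)))) →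
    ∀ (ρ : ℝ → ℝ) (Δ : ℝ) (S : CorrFamily 3), (∀ δ ∈ Set.Ioc (0:ℝ) 1, 0 < ρ δ) →
      HasPointwiseScalingLimit (criticalCorr 3) ρ S → (∀ n z, z ∉ NonCoincident 3 n → S n z = 0) →
      IsNondegenerateTwoPoint S → IsEuclideanInvariant S → IsScaleCovariant Δ S →
      ∀ (n m : ℕ) (x : Fin n → EuclideanSpace ℝ (Fin 3)) (y : Fin m → EuclideanSpace ℝ (Fin 3))
        (v : EuclideanSpace ℝ (Fin 3)), v ≠ 0 →
        Tendsto (fun t : ℝ => S (n + m) (Fin.append x (fun j => y j + t • v)) - S n x * S m y)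
          atTop (𝓝 0) := by
  intro hOO hPT ρ Δ S hρ hlim hnorm hnd heuc hsc n m x y v hv
  -- (A) `x` not injective: both terms vanish identically by normalisation.
  by_cases hx : Function.Injective x
  swap
  · have h0 : S n x = 0 := hnorm n x hx
    have hfun : (fun t : ℝ => S (n + m) (Fin.append x (fun j => y j + t • v)) - S n x * S m y) =
        fun _ => 0 := by
      funext t
      rw [h0, hnorm (n + m) (Fin.append x (fun j => y j + t • v))
        (fun h => hx (Fin.append_injective_iff.mp h).1)]
      ring
    rw [hfun]
    exact tendsto_const_nhds
  -- (B) `y` not injective: symmetric (a translate of a non-injective configuration is not injective).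
  by_cases hy : Function.Injective y
  swap
  · have h0 : S m y = 0 := hnorm m y hy
    have hfun : (fun t : ℝ => S (n + m) (Fin.append x (fun j => y j + t • v)) - S n x * S m y) =
        fun _ => 0 := by
      funext t
      rw [h0, hnorm (n + m) (Fin.append x (fun j => y j + t • v)) (fun h => hy
        (Function.Injective.of_comp
          (show Function.Injective ((· + t • v) ∘ y) from (Fin.append_injective_iff.mp h).2.1)))]
      ring
    rw [hfun]
    exact tendsto_const_nhds
  -- (C) both injective.  Odd orders vanish identically.
  have hodd : ∀ {k : ℕ} (z : Fin k → EuclideanSpace ℝ (Fin 3)), Odd k → S k z = 0 := fun z hk =>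
    InversionUpgradeNormalisedNegative.limit_odd_eq_zero hlim hnorm hk z
  rcases Nat.even_or_odd n with hn | hn
  swap
  · -- `n` odd: `S n x = 0`
    rcases Nat.even_or_odd m with hm | hm
    · -- `n + m` odd: the function vanishes identically
      have hfun : (fun t : ℝ => S (n + m) (Fin.append x (fun j => y j + t • v)) - S n x * S m y) =
          fun _ => 0 := by
        funext t
        rw [hodd _ (hn.add_even hm), hodd x hn]
        ring
      rw [hfun]
      exact tendsto_const_nhds
    · -- `n, m` odd: exactly the odd|odd decay
      have hfun : (fun t : ℝ => S (n + m) (Fin.append x (fun j => y j + t • v)) - S n x * S m y) =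
          fun t => S (n + m) (Fin.append x (fun j => y j + t • v)) := by
        funext t
        rw [hodd x hn]
        ring
      rw [hfun]
      exact hOO ρ Δ S hρ hlim hnorm hnd heuc hsc n m x y v hn hm hv
  rcases Nat.even_or_odd m with hm | hm
  swap
  · -- `n` even, `m` odd: the function vanishes identically
    have hfun : (fun t : ℝ => S (n + m) (Fin.append x (fun j => y j + t • v)) - S n x * S m y) =
        fun _ => 0 := by
      funext t
      rw [hodd _ (hn.add_odd hm), hodd y hm]
      ring
    rw [hfun]
    exact tendsto_const_nhds
  -- `n, m` even: pair truncation at the eventually injective configuration `(x, y + t v)`.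
  -- Each odd|odd summand is a product of two decaying factors.
  have hterm : ∀ I ∈ (Finset.univ : Finset (Fin n)).powerset.filter (fun I => Odd I.card),
      ∀ J ∈ (Finset.univ : Finset (Fin m)).powerset.filter (fun J => Odd J.card),
        Tendsto (fun t : ℝ =>
          S (I.card + J.card)
              (Fin.append (fun i => x (I.orderEmbOfFin rfl i))
                (fun j => y (J.orderEmbOfFin rfl j) + t • v)) *
            S (Iᶜ.card + Jᶜ.card)
              (Fin.append (fun i => x (Iᶜ.orderEmbOfFin rfl i))
                (fun j => y (Jᶜ.orderEmbOfFin rfl j) + t • v))) atTop (𝓝 (0 * 0)) := by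
    intro I hI J hJ
    have hIo : Odd I.card := (Finset.mem_filter.mp hI).2
    have hJo : Odd J.card := (Finset.mem_filter.mp hJ).2
    exact (hOO ρ Δ S hρ hlim hnorm hnd heuc hsc _ _ (fun i => x (I.orderEmbOfFin rfl i))
        (fun j => y (J.orderEmbOfFin rfl j)) v hIo hJo hv).mul
      (hOO ρ Δ S hρ hlim hnorm hnd heuc hsc _ _ (fun i => x (Iᶜ.orderEmbOfFin rfl i))
        (fun j => y (Jᶜ.orderEmbOfFin rfl j)) v (odd_card_compl_of_even hn hIo)
        (odd_card_compl_of_even hm hJo) hv)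
  -- Hence the odd|odd double sum tends to `0`, and so does its half.
  have hG : Tendsto (fun t : ℝ =>
      ∑ I ∈ (Finset.univ : Finset (Fin n)).powerset.filter (fun I => Odd I.card),
        ∑ J ∈ (Finset.univ : Finset (Fin m)).powerset.filter (fun J => Odd J.card),
          S (I.card + J.card)
              (Fin.append (fun i => x (I.orderEmbOfFin rfl i))
                (fun j => y (J.orderEmbOfFin rfl j) + t • v)) *
            S (Iᶜ.card + Jᶜ.card)
              (Fin.append (fun i => x (Iᶜ.orderEmbOfFin rfl i))
                (fun j => y (Jᶜ.orderEmbOfFin rfl j) + t • v))) atTop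
      (𝓝 (∑ I ∈ (Finset.univ : Finset (Fin n)).powerset.filter (fun I => Odd I.card),
        ∑ J ∈ (Finset.univ : Finset (Fin m)).powerset.filter (fun J => Odd J.card), (0 : ℝ) * 0)) :=
    tendsto_finsetSum _ fun I hI => tendsto_finsetSum _ fun J hJ => hterm I hI J hJ
  simp only [mul_zero, Finset.sum_const_zero] at hG
  have hG2 := hG.div_const 2
  rw [zero_div] at hG2
  -- Pair truncation, eventually in `t`, with `S m (y + t v) = S m y` (translation invariance).
  have hkey : ∀ᶠ t : ℝ in atTop,
      0 ≤ S (n + m) (Fin.append x (fun j => y j + t • v)) - S n x * S m y ∧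
      S (n + m) (Fin.append x (fun j => y j + t • v)) - S n x * S m y ≤
        (∑ I ∈ (Finset.univ : Finset (Fin n)).powerset.filter (fun I => Odd I.card),
          ∑ J ∈ (Finset.univ : Finset (Fin m)).powerset.filter (fun J => Odd J.card),
            S (I.card + J.card)
                (Fin.append (fun i => x (I.orderEmbOfFin rfl i))
                  (fun j => y (J.orderEmbOfFin rfl j) + t • v)) *
              S (Iᶜ.card + Jᶜ.card)
                (Fin.append (fun i => x (Iᶜ.orderEmbOfFin rfl i))
                  (fun j => y (Jᶜ.orderEmbOfFin rfl j) + t • v))) / 2 := by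
    filter_upwards [eventually_injective_append_add_smul hx hy hv] with t ht
    have h := hPT ρ S hρ hlim n m x (fun j => y j + t • v) hn hm ht
    rw [heuc.1 m (t • v) y] at h
    exact ⟨h.1, by linarith [h.2]⟩
  exact squeeze_zero' (hkey.mono fun t ht => ht.1) (hkey.mono fun t ht => ht.2) hG2

end Summit.CriticalPhenomena.Ising3DConformalLimit.Cruxes.InversionUpgradeNormalised.FreeEndpointGaussianClosure

end
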